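import Summits.QuantumFields.YangMills.Theorems.BalabanUVNodesN11NoExpansionStepSpecification
import Summits.QuantumFields.YangMills.Theorems.BalabanUVNodesN11OperandRowsOfTermRows
import Summits.QuantumFields.YangMills.Theorems.BalabanUVNodesN11BackgroundCoPMeasurable

/-!
# DAG node N11 — THE SPECIFICATION OF THE NO-EXPANSION 𝐓-STEP WITH THE OPERAND ROWS PUSHED DOWN TO def-T's TERM VALUES (def-R's background-map row
# being a THEOREM, `…N11BackgroundCoPMeasurable`): every hypothesis is now a row on a PRIMITIVE of record (the residual `θ.Zh` — K0b; the term values read at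
# the embedded background — def-T)

HEADER — WORK-UNIT METADATA.  Cell `pub-ymgap`, YM-PLAN Track A (HUMAN RULING D-0062), seat `pub-ymgap-dag-n11-d` (g10; R134 fan-out seat N11 [B14], strategy s2),
route `BalabanUVNodes` rev 25, item K1⁷ `StabilityBAtRecordR13SepCoPH` = stmt-QuantumFields-20542 (helper, `--kind proof --supports 20542 --as helper`, count-neutral).
[III] = [Balaban1988Convergent], [IV] = [Balaban1989LargeFieldI].  Over this seat's p583082 `…N11NoExpansionStepSpecification` (★★★ `exists_local_witness_clause_succ_of_sLaw₁₃CoPH_of_rows`)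
and `…N11OperandRowsOfTermRows` (`measurable_sect2Operand_of_termRows`, `exists_bound_sect2Operand_of_termBounds`), `…N11BackgroundCoPMeasurable`
(★★★ `measurable_UbgOfRecord₁₃CoP`: def-R's background map of record is measurable at every level — K0c's selection theorem over the open class on a support).

WHY THIS FILE.  p583082 lists, per no-expansion history and old branch, two rows on the §2 OPERAND (measurable on the multiscale configuration space; bounded).
The operand is a composite object (`exp` of r11's (2.23) action of the witness at def-R's background); the rows its owners can actually supply are rows on
their PRIMITIVES: measurability of def-R's background map `𝐖 ↦ U_k(𝐖)` and, for def-T, measurability ∕ uniform boundedness of the term values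
`𝐄^{(j)}(X, ι U, z)`, `𝐑^{(j)}(X, ι U)`, `𝐁^{(j)}(X, ι U, ({S_i}, A))` READ AT THE EMBEDDED BACKGROUND (the printed (2.27), (2.31), (2.41) are such bounds).
`…N11OperandRowsOfTermRows` proved operand rows ⟸ primitive rows, and `…N11BackgroundCoPMeasurable` proved the def-R primitive row outright; this file is the one
substitution.

WHAT THIS FILE PROVES (0 `sorry`, 0 `def`).  ★★★ `exists_local_witness_clause_succ_of_sLaw₁₃CoPH_of_termRows` — p583082's specification with hypothesis
«operand measurable ∧ bounded per old branch» replaced by the three measurability rows and the three uniform bounds of the witness's term values at the parent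
history, read at the embedded background (def-T); NO def-R row remains (the background map of record is measurable, `measurable_UbgOfRecord₁₃CoP`).

HONEST FRAMING.  Helper lane of K1⁷; kernel bookkeeping (one composition); nothing of Bałaban's is asserted — every analytic input is DISPLAYED as a row on
the data; the expansion steps `Ω_{k+1} ≠ ∅` are untouched ([III] §3 ∕ Thm 2).  N11 NOT discharged; K1⁷ NOT closed; counts unmoved (typed 28∕28 · discharged
5∕27).  One finite four-torus programme at fixed `ε = L^{−K}` — NOT ℝ⁴, NOT OS, NOT a mass gap, NOT Clay.  No `sorry`, `axiom`, `instance`, `notation`.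
Sources (SHAPE only): [III] Theorem p.245, (2.12) p.256, (2.17)–(2.18) p.257, (2.20)–(2.27) pp.258–259, (2.30)–(2.31) p.260, (2.40)–(2.41) p.261, (3.16)–(3.21)
pp.268–269, (3.23)–(3.25) p.270, Thm 1 p.262; [IV] (0.2)–(0.3) p.176.
-/

noncomputable section

open MeasureTheory
open scoped BigOperators ENNReal NNReal Matrix.Norms.L2Operator

namespace Summit.QuantumFields.YangMills.Theorems.BalabanUVNodesN11NoExpansionStepSpecificationOfTermRows

open Literature.MathematicalPhysics.QuantumFieldTheory.Balaban1983to89 T4Continuum T4NestedCovariance Node00 Node00.Tk DagBinding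
open B15DeterminingSets
open BalabanUVNodesN11FluctTruncationDefs (IsFluctLocal)
open BalabanUVNodesN11NoExpansionStepSpecification (exists_local_witness_clause_succ_of_sLaw₁₃CoPH_of_rows)
open BalabanUVNodesN11OperandRowsOfTermRows (measurable_sect2Operand_of_termRows exists_bound_sect2Operand_of_termBounds)
open BalabanUVNodesN11BackgroundCoPMeasurable (measurable_UbgOfRecord₁₃CoP)

variable {F : T4Family} {N : ℕ} [NeZero N]

variable (θ : Stage13HParams F N) (p : B12.RunParams)

/-- **★★★ THE SPECIFICATION OF THE NO-EXPANSION 𝐓-STEP AT A GENERIC STAGE-13 PARAMETER, EVERY ROW ON A PRIMITIVE OF RECORD.**  As p583082's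
`exists_local_witness_clause_succ_of_sLaw₁₃CoPH_of_rows`, with the per-branch operand rows replaced by def-T's term rows (measurable ∕ uniformly bounded term
values read at the embedded background); def-R's background-map measurability is supplied by `measurable_UbgOfRecord₁₃CoP`.
[cite: Balaban1988Convergent, Theorem p.245, Thm 1 p.262, (2.12) p.256, (2.18) p.257, (2.23)–(2.27) pp.258–259, (2.31) p.260, (2.41) p.261, (3.24)–(3.25) p.270; Balaban1989LargeFieldI, (0.2)–(0.3) p.176] -/
theorem exists_local_witness_clause_succ_of_sLaw₁₃CoPH_of_termRows (h : θ.Provisos₁₃CoPH F N) (hU : θ.ZhUnity F N) {k : ℕ} (hk : k < p.K) (hM : 1 ≤ θ.τ9.M)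
    (hS : SLaw₁₃CoPH F N θ p k) :
    ∃ (t : SeqOfRecord F θ.ν θ.τ9.M (gOfRecord₁₃ F N θ.toStage13Params p) p.K k → Sect2.TermValues (F.P p.K) (MatA N) (FluctV N) θ.τ9.M)
      (Ek : SeqOfRecord F θ.ν θ.τ9.M (gOfRecord₁₃ F N θ.toStage13Params p) p.K k → ℝ),
      HasSect2FormAtZS F N (FluctV N) p.K (settingOfRecord₁₃ F N θ.toStage13Params p) k (θ.rzAt p) (WtOfRecord₁₃H F N θ p)
          (UbgOfRecord₁₃CoP F N θ.toStage13Params p k)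
          (fun s₀ t₀ => Sect2.LawsRT (sect2TowerOfRecord F N (FluctV N) p.K (settingOfRecord₁₃ F N θ.toStage13Params p) (θ.rzAt p s₀) s₀ t₀)
            (settingOfRecord₁₃ F N θ.toStage13Params p).lf k)
          (slotsOfRecord F N θ.ν θ.τ9 (EOfRecord₁₃ F N θ.toStage13Params) (wOfRecord₉ F N θ.toStage9Params) θ.ppSel p
            (gOfRecord₁₃ F N θ.toStage13Params p) k) t Ek ∧
      (∀ s₀, IsFluctLocal k (t s₀)) ∧
      ∀ (s : SeqOfRecord F θ.ν θ.τ9.M (gOfRecord₁₃ F N θ.toStage13Params p) p.K (k + 1)), s.Ω (k + 1) = ∅ →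
        -- (P) prefix agreement below `k`
        (∀ j, j < k → (θ.zhAt p s).ζ0 j = (θ.zhAt p s.init).ζ0 j ∧ (θ.zhAt p s).quad j = (θ.zhAt p s.init).quad j) →
        -- (V) the generation-`k` pin with the old front factor
        (∀ (V' : GaugeField (F.P p.K) (k + 1) (SU N)) (U₀ : GaugeField (F.P p.K) k (SU N)),
          (θ.zhAt p s).ζ0 k Set.univ (pairCfgAt (V := FluctV N) k V' U₀) =
            chiSeqOfRecord F N θ.ν θ.τ9.M (gOfRecord₁₃ F N θ.toStage13Params p) p.K k s.init U₀ *
              wOfRecord₉ F N θ.toStage9Params p (gOfRecord₁₃ F N θ.toStage13Params p) k s U₀ ((avOfRecord F N p.K k).avg U₀)) →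
        -- `quad_k(∅) = 0` on the two-scale configurations
        (∀ (V' : GaugeField (F.P p.K) (k + 1) (SU N)) (U₀ : GaugeField (F.P p.K) k (SU N)), (θ.zhAt p s).quad k ∅ (pairCfgAt (V := FluctV N) k V' U₀) = 0) →
        -- `k`-locality of `quad_j(Λ_{j+1})`, `j < k`
        (∀ j, j < k → ∀ ω ω' : MultiCfg (F.P p.K) (SU N) (FluctV N), (∀ i, i ≤ k → ω i = ω' i) →
          (θ.zhAt p s).quad j (s.init.Λ (j + 1)) ω = (θ.zhAt p s).quad j (s.init.Λ (j + 1)) ω') →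
        -- measurability of the residual serving `s′`
        (∀ j (Y : Set (Site (F.P p.K) 0)), Measurable ((θ.zhAt p s).ζ0 j Y)) →
        (∀ j (Λ' : Set (Site (F.P p.K) 0)), Measurable ((θ.zhAt p s).quad j Λ')) →
        -- per old branch: A-fibre domination (K0b)
        (∀ S ∈ admSOfRecord F θ.ν θ.τ9.M (gOfRecord₁₃ F N θ.toStage13Params p) p.K k s.init, ∀ j : ℕ,
          ∃ ŵ : (↥(Set.toFinite (B10Eq42TorusConstraint.bondsIn j ((s.init.Λ (j + 1))ᶜ ∩ s.init.Ω (j + 1)))).toFinset → FluctV N) → ℝ≥0∞, Measurable ŵ ∧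
            (∫⁻ a, ŵ a ∂(Measure.pi fun _ : ↥(Set.toFinite (B10Eq42TorusConstraint.bondsIn j ((s.init.Λ (j + 1))ᶜ ∩ s.init.Ω (j + 1)))).toFinset => (volume : Measure (FluctV N)))) ≠ ⊤ ∧
            ∀ ω, ENNReal.ofReal ((WtOfRecord₁₃H F N θ p s).w j (s.init.Λ (j + 1)) ((s.init.Λ (j + 1))ᶜ ∩ s.init.Ω (j + 1)) (S (j + 1)) ω) ≤
              ŵ (fun b : ↥(Set.toFinite (B10Eq42TorusConstraint.bondsIn j ((s.init.Λ (j + 1))ᶜ ∩ s.init.Ω (j + 1)))).toFinset => (ω j).2 b)) →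
        -- def-T: the term values of the witness at the parent history, READ AT THE EMBEDDED BACKGROUND, are measurable …
        (∀ (j : ℕ) (X : (Sect2.domSys (F.P p.K) θ.τ9.M j).Dom) (z : Site (F.P p.K) j) (g' : ℝ),
          Measurable (fun U : GaugeField (F.P p.K) 0 (SU N) => ((t s.init).E j X z g' (Sect2.ofBackgroundC (settingOfRecord₁₃ F N θ.toStage13Params p).ι U)).re)) →
        (∀ (j : ℕ) (X : (Sect2.domSys (F.P p.K) θ.τ9.M j).Dom),
          Measurable (fun U : GaugeField (F.P p.K) 0 (SU N) => ((t s.init).R j X (Sect2.ofBackgroundC (settingOfRecord₁₃ F N θ.toStage13Params p).ι U)).re)) →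
        (∀ (S' : ℕ → Set (Site (F.P p.K) 0)) (j : ℕ) (X : (Sect2.domSys (F.P p.K) θ.τ9.M j).Dom),
          Measurable (fun q : GaugeField (F.P p.K) 0 (SU N) × MSFluct (F.P p.K) (FluctV N) =>
            ((t s.init).B j X (Sect2.ofBackgroundC (settingOfRecord₁₃ F N θ.toStage13Params p).ι q.1) (S', q.2)).re)) →
        -- … and uniformly bounded
        (∃ CE : ℝ, ∀ (j : ℕ) (X : (Sect2.domSys (F.P p.K) θ.τ9.M j).Dom) (z : Site (F.P p.K) j) (g' : ℝ) (U : GaugeField (F.P p.K) 0 (SU N)),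
          |((t s.init).E j X z g' (Sect2.ofBackgroundC (settingOfRecord₁₃ F N θ.toStage13Params p).ι U)).re| ≤ CE) →
        (∃ CR : ℝ, ∀ (j : ℕ) (X : (Sect2.domSys (F.P p.K) θ.τ9.M j).Dom) (U : GaugeField (F.P p.K) 0 (SU N)),
          |((t s.init).R j X (Sect2.ofBackgroundC (settingOfRecord₁₃ F N θ.toStage13Params p).ι U)).re| ≤ CR) →
        (∃ CB : ℝ, ∀ (j : ℕ) (X : (Sect2.domSys (F.P p.K) θ.τ9.M j).Dom) (U : GaugeField (F.P p.K) 0 (SU N)) (a : Tk.SFluct (F.P p.K) (FluctV N)),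
          |((t s.init).B j X (Sect2.ofBackgroundC (settingOfRecord₁₃ F N θ.toStage13Params p).ι U) a).re| ≤ CB) →
        (slotsTOfRecord F N θ.ν θ.τ9 (EOfRecord₁₃ F N θ.toStage13Params) (wOfRecord₉ F N θ.toStage9Params) θ.ppSel p
            (gOfRecord₁₃ F N θ.toStage13Params p) (k + 1) s = 0 ∨
          ∀ᵐ V' ∂fieldMeasure (F.P p.K) (k + 1) (SU N),
            chiSeqOfRecord F N θ.ν θ.τ9.M (gOfRecord₁₃ F N θ.toStage13Params p) p.K (k + 1) s V' ≠ 0 →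
              slotsTOfRecord F N θ.ν θ.τ9 (EOfRecord₁₃ F N θ.toStage13Params) (wOfRecord₉ F N θ.toStage9Params) θ.ppSel p
                  (gOfRecord₁₃ F N θ.toStage13Params p) (k + 1) s V' =
                sect2Slot F N (FluctV N) p.K (settingOfRecord₁₃ F N θ.toStage13Params p) (θ.rzAt p s) (WtOfRecord₁₃H F N θ p s) s
                  (t s.init) (Ek s.init) (UbgOfRecord₁₃CoP F N θ.toStage13Params p (k + 1) s) V') := by
  obtain ⟨t, Ek, hform, hloc, H⟩ := exists_local_witness_clause_succ_of_sLaw₁₃CoPH_of_rows θ p h hU hk hM hS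
  refine ⟨t, Ek, hform, hloc, fun s hΩ hpre hZ hq hqloc hζm hqm hW hE hR hB hEb hRb hBb => ?_⟩
  exact H s hΩ hpre hZ hq hqloc hζm hqm hW fun S _ =>
    ⟨measurable_sect2Operand_of_termRows p.K _ _ s.init (t s.init) (Ek s.init) (measurable_UbgOfRecord₁₃CoP F N θ.toStage13Params p k s.init) S hE hR (hB S),
      exists_bound_sect2Operand_of_termBounds p.K _ _ s.init (t s.init) (Ek s.init) _ hEb hRb hBb⟩

end Summit.QuantumFields.YangMills.Theorems.BalabanUVNodesN11NoExpansionStepSpecificationOfTermRows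

end
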